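import Literature.Analysis.FluidPDE.GalerkinFlow

/-!
# Stub `stub_steadyFixedPoint` of the line `SketchIdeator1` (crux stmt-AnomalousDissipation-10352,
# `WazewskiBlock.UniformGalerkinTrap`): a steady Galerkin state is an equilibrium of `Torus.galerkinFlow`

The registered transfer stub of the line (arm β, frozen faces): a Galerkin mode `U` of order `N` solving the tested
steady Galerkin equations `∫ ⟪U,(U·∇)a⟫ + ν⟪U,Δa⟫ + ⟪f,a⟫ = 0` against every Galerkin mode `a` of order `N` is a fixed
point of the tree's Galerkin semiflow `Torus.galerkinFlow ν f N` (`ν ≥ 0`, `f ∈ L²`). Two steps, both elementary: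

* `galerkinRHS_fourierRestrict_eq_zero_of_steady` — the tested equations say that the Galerkin vector field vanishes at
  `Û|_{≤N}`: test with the (real, divergence-free, band-limited) field of the residual `V = galerkinRHS … (Û|_{≤N})` and
  read the master identity `sum_re_inner_galerkinField_test` (Robinson–Rodrigo–Sadowski 2016, (4.5)) as `∑ ‖V k‖² = 0`;
* `galerkinFlow_eq_self_of_rhs_zero` — a zero of `galerkinRHS` is an equilibrium: the constant coefficient curve is a
  global solution of the Galerkin ODE, hence THE orbit (`IsGalerkinODESolution.galerkinCoeffFlow_eq`, uniqueness,
  Constantin–Foias 1988 Ch. 8 (8.5)–(8.6));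
* `stub_steadyFixedPoint` — the registered signature (on `T³`).

References: R. Temam, *Navier–Stokes Equations* (1979) Ch. II §1 (1.25)–(1.29) (steady Galerkin states);
J. C. Robinson, J. L. Rodrigo, W. Sadowski (2016) §4.1, Thm 4.4 Step 1; P. Constantin, C. Foias (1988) Ch. 8.
-/

noncomputable section

-- `Summit.<Summit>.<Problem>` is the tree's mandated summit-side namespace (CONVENTIONS §2); deliberate duplicate.
set_option linter.dupNamespace false

open MeasureTheory Set UnitAddTorus
open scoped InnerProductSpace

namespace Summit.AnomalousDissipation.AnomalousDissipation.Theorems.UniformGalerkinTrap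

open Literature.Analysis.FunctionSpaces Literature.Analysis.FunctionSpaces.Torus
open Literature.Analysis.FluidPDE Literature.Analysis.FluidPDE.Torus

variable {d : Type*} [Fintype d] [DecidableEq d]

/-- **The tested steady Galerkin equations say `galerkinRHS = 0`.** If a Galerkin mode `U` of order `N` satisfies
`∫ ⟪U,(U·∇)a⟫ + ν⟪U,Δa⟫ + ⟪f,a⟫ = 0` for every Galerkin mode `a` of order `N` (`f ∈ L²`), then the Galerkin vector field
of order `N` with force coefficients `f̂|_{≤N}` vanishes at `Û|_{≤N}`.  Proof: the residual `V := galerkinRHS …` lies in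
the Galerkin phase space (`galerkinRHS_mem`), so `a := realTrigPoly (freqBall N) V̄` is an admissible test; by the master
identity `sum_re_inner_galerkinField_test` (with `P_N f` replaced by `f` against the band-limited `a`) the tested form at
`a` equals `∑_k Re⟪V k, V k⟫ = ∑_k ‖V k‖²`, which therefore vanishes. [folklore] -/
theorem galerkinRHS_fourierRestrict_eq_zero_of_steady {ν : ℝ} {N : ℕ}
    {f U : UnitAddTorus d → EuclideanSpace ℝ d} (hf : MemLp f 2 volume) (hU : IsGalerkinMode N U)
    (hsteady : ∀ a : UnitAddTorus d → EuclideanSpace ℝ d, IsGalerkinMode N a →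
      ∫ x, (⟪U x, convect U a x⟫_ℝ + ν * ⟪U x, laplacian a x⟫_ℝ + ⟪f x, a x⟫_ℝ) = 0) :
    galerkinRHS (freqBall N) ν (fourierRestrict (freqBall N) f) (fourierRestrict (freqBall N) U) = 0 := by
  set S : Finset (d → ℤ) := freqBall N with hSdef
  have hS : ∀ k ∈ S, -k ∈ S := neg_mem_freqBall_of_mem
  set c : ↥S → EuclideanSpace ℂ d := fourierRestrict S U with hcdef
  set g : ↥S → EuclideanSpace ℂ d := fourierRestrict S f with hgdef
  have hc : c ∈ galerkinSubspace S := hU.fourierRestrict_mem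
  have hg : IsRealCoeff g := isRealCoeff_mFourierCoeff (hf.integrable one_le_two)
  set V : ↥S → EuclideanSpace ℂ d := galerkinRHS S ν g c with hVdef
  have hVmem : V ∈ galerkinSubspace S := galerkinRHS_mem ν hS hg hc
  -- the test field of the residual
  set a : UnitAddTorus d → EuclideanSpace ℝ d := realTrigPoly S (coeffExt S V) with hadef
  have ha : IsGalerkinMode N a := isGalerkinMode_realTrigPoly_coeffExt hVmem
  have hband : ∀ k ∉ S, mFourierCoeff (EuclideanSpace.complexify ∘ a) k = 0 :=
    fun k hk => ha.mFourierCoeff_eq_zero (not_mem_freqBall.1 hk)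
  have hâ : ∀ k ∈ S, mFourierCoeff (EuclideanSpace.complexify ∘ a) k = coeffExt S V k := by
    intro k hk
    rw [hadef, mFourierCoeff_realTrigPoly hS (hVmem.1.isConjSymm_coeffExt hS), if_pos hk]
  -- master identity I at the test field `a`
  have hid := sum_re_inner_galerkinField_test ν hS (hg.isConjSymm_coeffExt hS)
    (hc.1.isConjSymm_coeffExt hS) hc.2.isTransversal_coeffExt ha.isSmooth ha.isDivFree hband
  -- the velocity is `U`, the Galerkin force is `P_N f`
  have hUeq : realTrigPoly S (coeffExt S c) = U := hU.realTrigPoly_fourierRestrict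
  have hGeq : realTrigPoly S (coeffExt S g) = fourierTruncate N f := realTrigPoly_coeffExt_fourierRestrict N f
  rw [hUeq, hGeq] at hid
  -- replace `P_N f` by `f` against the band-limited test field
  have hforce : ∫ x, ⟪fourierTruncate N f x, a x⟫_ℝ = ∫ x, ⟪f x, a x⟫_ℝ :=
    integral_inner_fourierTruncate_eq hf (ha.isSmooth.memLp 2) hband
  have hUs : IsSmooth U := hU.isSmooth
  have iAB : Integrable (fun x => ⟪U x, convect U a x⟫_ℝ + ν * ⟪U x, laplacian a x⟫_ℝ) volume :=
    (hUs.inner (hUs.convect ha.isSmooth)).integrable.add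
      (((hUs.inner ha.isSmooth.laplacian).integrable).const_mul ν)
  have iP : Integrable (fun x => ⟪fourierTruncate N f x, a x⟫_ℝ) volume :=
    ((isSmooth_fourierTruncate N f).inner ha.isSmooth).integrable
  have iF : Integrable (fun x => ⟪f x, a x⟫_ℝ) volume :=
    integrable_inner_of_continuous (hf.integrable one_le_two) ha.isSmooth.continuous
  have htested : ∫ x, (⟪U x, convect U a x⟫_ℝ + ν * ⟪U x, laplacian a x⟫_ℝ + ⟪fourierTruncate N f x, a x⟫_ℝ) = 0 := by
    rw [integral_add iAB iP, hforce, ← integral_add iAB iF]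
    exact hsteady a ha
  rw [htested] at hid
  -- read the left-hand side as `∑ ‖V k‖²`
  have hsum : ∑ k ∈ S, (inner ℂ (galerkinField ν S (coeffExt S g) (coeffExt S c) k)
      (mFourierCoeff (EuclideanSpace.complexify ∘ a) k)).re = ∑ k : ↥S, ‖V k‖ ^ 2 := by
    rw [← Finset.sum_coe_sort]
    refine Finset.sum_congr rfl fun k _ => ?_
    rw [hâ k k.2, coeffExt_coe, ← galerkinRHS_apply, ← hVdef, ← RCLike.re_to_complex, inner_self_eq_norm_sq]
  rw [hsum] at hid
  -- hence every `V k` vanishes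
  have hzero : ∀ k : ↥S, ‖V k‖ ^ 2 = 0 := fun k =>
    (Finset.sum_eq_zero_iff_of_nonneg fun k _ => sq_nonneg ‖V k‖).1 hid k (Finset.mem_univ k)
  funext k
  have hk := hzero k
  rw [sq_eq_zero_iff, norm_eq_zero] at hk
  rw [hk]
  rfl

/-- **Zeros of the Galerkin vector field are equilibria of the semiflow.** If `U` is a Galerkin mode of order `N` and
`galerkinRHS (freqBall N) ν f̂|_{≤N} Û|_{≤N} = 0`, then `Torus.galerkinFlow ν f N t U = U` for all `t ≥ 0`: the constant
coefficient curve is a global solution of the Galerkin ODE from `Û|_{≤N}`, hence the orbit by uniqueness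
(`IsGalerkinODESolution.galerkinCoeffFlow_eq`), and `realTrigPoly (Û|_{≤N})‾ = U`. [folklore] -/
theorem galerkinFlow_eq_self_of_rhs_zero {ν : ℝ} {N : ℕ} {f U : UnitAddTorus d → EuclideanSpace ℝ d}
    (hU : IsGalerkinMode N U)
    (h0 : galerkinRHS (freqBall N) ν (fourierRestrict (freqBall N) f) (fourierRestrict (freqBall N) U) = 0)
    {t : ℝ} (ht : 0 ≤ t) : Torus.galerkinFlow ν f N t U = U := by
  have hsol : IsGalerkinODESolution ν (fourierRestrict (freqBall N) f)
      (fourierRestrict (freqBall N) U) (fun _ => fourierRestrict (freqBall N) U) :=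
    ⟨rfl, fun _ => hU.fourierRestrict_mem, continuousOn_const, fun T s _ => by
      simpa [h0] using hasDerivWithinAt_const s (Icc 0 T) (fourierRestrict (freqBall N) U)⟩
  rw [hU.galerkinFlow_eq, hsol.galerkinCoeffFlow_eq ht, hU.realTrigPoly_fourierRestrict]

/-- **Registered stub `stub_steadyFixedPoint` of the line `SketchIdeator1` (crux stmt-AnomalousDissipation-10352).**
A steady Galerkin state of order `N` on `T³` — a Galerkin mode `U` solving the tested steady Galerkin equations against
every Galerkin mode of order `N` — is an equilibrium of `Torus.galerkinFlow ν f N` (`f ∈ L²`; any real `ν`). [folklore] -/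
theorem stub_steadyFixedPoint {ν : ℝ} {N : ℕ}
    {f U : UnitAddTorus (Fin 3) → EuclideanSpace ℝ (Fin 3)} (hf : MemLp f 2 volume)
    (hU : IsGalerkinMode N U)
    (hsteady : ∀ a : UnitAddTorus (Fin 3) → EuclideanSpace ℝ (Fin 3), IsGalerkinMode N a →
      ∫ x, (⟪U x, convect U a x⟫_ℝ + ν * ⟪U x, laplacian a x⟫_ℝ + ⟪f x, a x⟫_ℝ) = 0)
    {t : ℝ} (ht : 0 ≤ t) : Torus.galerkinFlow ν f N t U = U :=
  galerkinFlow_eq_self_of_rhs_zero hU (galerkinRHS_fourierRestrict_eq_zero_of_steady hf hU hsteady) ht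

end Summit.AnomalousDissipation.AnomalousDissipation.Theorems.UniformGalerkinTrap

end
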